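import Summits.AtomisticToContinuum.FouriersLaw.Theorems.BondHeatUncertaintySubdiffusiveBondHeatKernelGibbsC
import Literature.MathematicalPhysics.KineticTheory.SdeGeneratorCalculus

/-!
# Uniqueness of the weak steady state (`NessUnique`), part 3: the energy cutoff `χ(H/R)`

Support file for item `stmt-AtomisticToContinuum-0741` (`EmbeddedDrudeMourre.NessUnique`). Calculus of the
energy cutoff `a_R = χ(H/R)` (`χ = smoothCutoff`: `1` on `H ≤ R`, `0` on `H ≥ 2R`) for an oscillator chain with
confining `C²` potentials (`U, V ≥ 0`), `N ≥ 1`, `γ ≥ 0`, `T_L, T_R ≥ 0`: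

* `generator_comp_hamiltonian` — the FORWARD generator of a function of the energy,
  `L(F∘H) = γ[F'(H)(T_L + T_R - A - B) + F''(H)(T_L A + T_R B)]`, `A = p_0²`, `B = p_{N-1}²`
  (twin of the tree's `revGenerator_comp_hamiltonian`);
* the cutoff `a_R = χ(H/R)` (written `fun y => smoothCutoff (P.hamiltonian N y / R)`): `C²`, values in `[0,1]`, `= 1` on `{H ≤ R}`, `= 0` on `{2R ≤ H}`, compactly
  supported (`IsConfining`);
* uniform bounds for `R ≥ 1`: `|L a_R| ≤ K`, `|L̂ a_R| ≤ K` with `L̂ a_R = 0` off `{R ≤ H ≤ 2R}`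
  (`abs_generator_energyCutoff_le`, `abs_revGenerator_energyCutoff_le`), and the bath derivatives
  `|D a_R · v_b| ≤ C/√R`, vanishing off the shell (`abs_fderiv_energyCutoff_bathVec_le`).
-/

noncomputable section

open MeasureTheory Filter Topology Set
open scoped ContDiff NNReal ENNReal

namespace Summit.AtomisticToContinuum.FouriersLaw.Theorems.NessUnique

open Literature.MathematicalPhysics.KineticTheory.HeatConduction
open Literature.MathematicalPhysics.KineticTheory OscillatorChain
open Summit.AtomisticToContinuum.FouriersLaw.Theorems.SubdiffusiveBondHeat

variable {N : ℕ} {P : OscillatorChain}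

/-! ### The forward generator of a function of the energy -/

/-- **The forward generator of a function of the energy**: for `C²` potentials, `N ≥ 1`,
`γT_L, γT_R ≥ 0` and `F` twice differentiable, with `A = p_0²`, `B = p_{N-1}²`,
`L (F∘H) = γ [F'(H) (T_L + T_R - A - B) + F''(H) (T_L A + T_R B)]`
(`L H = γ(T_L + T_R - A - B)`, `(DH·v_b)² = 2γT_b p_b²`). [folklore] -/
theorem generator_comp_hamiltonian (hU : ContDiff ℝ 2 P.U) (hV : ContDiff ℝ 2 P.V) (hN : 0 < N)
    {T_L T_R : ℝ} (hL : 0 ≤ P.γ * T_L) (hR : 0 ≤ P.γ * T_R) {F F' F'' : ℝ → ℝ}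
    (hF : ∀ u, HasDerivAt F (F' u) u) (hF' : ∀ u, HasDerivAt F' (F'' u) u) (x : PhaseSpace N) :
    sdeGenerator (P.drift N) (P.bathVecL N T_L) (P.bathVecR N T_R)
        (fun y => F (P.hamiltonian N y)) x =
      P.γ * (F' (P.hamiltonian N x) *
          (T_L + T_R - x.2 ⟨0, hN⟩ ^ 2 - x.2 ⟨N - 1, Nat.sub_lt hN one_pos⟩ ^ 2) +
        F'' (P.hamiltonian N x) *
          (T_L * x.2 ⟨0, hN⟩ ^ 2 + T_R * x.2 ⟨N - 1, Nat.sub_lt hN one_pos⟩ ^ 2)) := by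
  have hH2 : ContDiff ℝ 2 (P.hamiltonian N) := P.contDiff_hamiltonian hU hV N
  have hHd : Differentiable ℝ (P.hamiltonian N) := hH2.differentiable (by norm_num)
  -- compare with the reversed generator: `L = L̂ + 2 DH·Y` on functions of `H`
  have hrev := revGenerator_comp_hamiltonian hU hV hN hL hR hF hF' x
  have hdiff : sdeGenerator (P.drift N) (P.bathVecL N T_L) (P.bathVecR N T_R)
        (fun y => F (P.hamiltonian N y)) x =
      sdeGenerator (fun y => -P.drift N y) (P.bathVecL N T_L) (P.bathVecR N T_R)
        (fun y => F (P.hamiltonian N y)) x +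
        2 * (F' (P.hamiltonian N x) * fderiv ℝ (P.hamiltonian N) x (P.drift N x)) := by
    rw [sdeGenerator_def, sdeGenerator_def, fderiv_comp_eq_smul hF hHd]
    simp only [FunLike.coe_smul, Pi.smul_apply, smul_eq_mul, map_neg]
    ring
  rw [hdiff, hrev, fderiv_hamiltonian_drift P hHd, sum_bathWeight_mul_sq hN]
  ring

/-! ### The energy cutoff `a_R = χ(H/R)` -/

/-- `0 ≤ a_R ≤ 1`. [folklore] -/
theorem energyCutoff_mem_Icc (R : ℝ) (x : PhaseSpace N) : smoothCutoff (P.hamiltonian N x / R) ∈ Icc (0 : ℝ) 1 :=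
  ⟨smoothCutoff_nonneg _, smoothCutoff_le_one _⟩

/-- `a_R = 1` on `{H ≤ R}` (`R > 0`). [folklore] -/
theorem energyCutoff_eq_one {R : ℝ} (hR : 0 < R) {x : PhaseSpace N} (hx : P.hamiltonian N x ≤ R) :
    smoothCutoff (P.hamiltonian N x / R) = 1 :=
  smoothCutoff_of_le_one (by rwa [div_le_one hR])

/-- `a_R = 0` on `{2R ≤ H}` (`R > 0`). [folklore] -/
theorem energyCutoff_eq_zero {R : ℝ} (hR : 0 < R) {x : PhaseSpace N} (hx : 2 * R ≤ P.hamiltonian N x) :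
    smoothCutoff (P.hamiltonian N x / R) = 0 :=
  smoothCutoff_of_two_le (by rwa [le_div_iff₀ hR])

/-- `a_R` is `C²` for `C²` potentials. [folklore] -/
theorem contDiff_energyCutoff (hU : ContDiff ℝ 2 P.U) (hV : ContDiff ℝ 2 P.V) (N : ℕ) (R : ℝ) :
    ContDiff ℝ 2 (fun y => smoothCutoff (P.hamiltonian N y / R)) :=
  (contDiff_smoothCutoff (n := 2)).comp ((P.contDiff_hamiltonian hU hV N).div_const R)

/-- `a_R` has compact support for confining potentials (`R > 0`). [folklore] -/
theorem hasCompactSupport_energyCutoff (hP : P.IsConfining) (N : ℕ) {R : ℝ} (hR : 0 < R) :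
    HasCompactSupport (fun y => smoothCutoff (P.hamiltonian N y / R)) :=
  HasCompactSupport.intro (hP.isCompact_setOf_hamiltonian_le N (2 * R)) fun x hx =>
    energyCutoff_eq_zero hR (le_of_lt (by simpa using hx))

/-- The cutoff profile `h ↦ χ(h/R)` and its first two derivatives. [folklore] -/
theorem hasDerivAt_cutoffProfile (R u : ℝ) :
    HasDerivAt (fun h => smoothCutoff (h / R)) (deriv smoothCutoff (u / R) / R) u := by
  have hid : HasDerivAt (fun h : ℝ => h / R) (1 / R) u := by simpa using (hasDerivAt_id u).div_const R
  have := (hasDerivAt_smoothCutoff (u / R)).comp u hid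
  simp only [Function.comp_def] at this
  exact this.congr_deriv (by ring)

/-- Second derivative of the cutoff profile. [folklore] -/
theorem hasDerivAt_deriv_cutoffProfile (R u : ℝ) :
    HasDerivAt (fun h => deriv smoothCutoff (h / R) / R) (deriv (deriv smoothCutoff) (u / R) / R ^ 2) u := by
  have hid : HasDerivAt (fun h : ℝ => h / R) (1 / R) u := by simpa using (hasDerivAt_id u).div_const R
  have := ((hasDerivAt_deriv_smoothCutoff (u / R)).comp u hid).div_const R
  simp only [Function.comp_def] at this
  exact this.congr_deriv (by field_simp)

/-- On the support of `χ'(H/R)` the energy lies in `[R, 2R]`: if `H/R ∉ [1, 2]` the derivative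
terms vanish. [folklore] -/
theorem deriv_smoothCutoff_div_eq_zero {R h : ℝ} (hR : 0 < R) (hh : h < R ∨ 2 * R < h) :
    deriv smoothCutoff (h / R) = 0 := by
  refine deriv_smoothCutoff_eq_zero_of_notMem fun hm => ?_
  rcases hh with hh | hh
  · have : 1 ≤ h / R := hm.1
    rw [le_div_iff₀ hR] at this; linarith
  · have : h / R ≤ 2 := hm.2
    rw [div_le_iff₀ hR] at this; linarith

/-- Likewise for `χ''(H/R)`. [folklore] -/
theorem deriv_deriv_smoothCutoff_div_eq_zero {R h : ℝ} (hR : 0 < R) (hh : h < R ∨ 2 * R < h) :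
    deriv (deriv smoothCutoff) (h / R) = 0 := by
  have hopen : ∀ u : ℝ, u ∉ Icc (1 : ℝ) 2 → deriv (deriv smoothCutoff) u = 0 := by
    intro u hu
    have hnhds : (Icc (1 : ℝ) 2)ᶜ ∈ 𝓝 u := isClosed_Icc.isOpen_compl.mem_nhds hu
    have h : deriv smoothCutoff =ᶠ[𝓝 u] fun _ => (0 : ℝ) := by
      filter_upwards [hnhds] with w hw
      exact deriv_smoothCutoff_eq_zero_of_notMem hw
    rw [h.deriv_eq, deriv_const]
  refine hopen _ fun hm => ?_
  rcases hh with hh | hh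
  · have : 1 ≤ h / R := hm.1
    rw [le_div_iff₀ hR] at this; linarith
  · have : h / R ≤ 2 := hm.2
    rw [div_le_iff₀ hR] at this; linarith

/-- The squared bath momenta are bounded by `4H` (`U, V ≥ 0`). [folklore] -/
theorem bath_sq_le_four_mul_hamiltonian (hU0 : ∀ q, 0 ≤ P.U q) (hV0 : ∀ r, 0 ≤ P.V r) (hN : 0 < N)
    (x : PhaseSpace N) :
    x.2 ⟨0, hN⟩ ^ 2 + x.2 ⟨N - 1, Nat.sub_lt hN one_pos⟩ ^ 2 ≤ 4 * P.hamiltonian N x := by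
  have hk := P.kinetic_le_hamiltonian_of_nonneg hU0 hV0 N x
  have h1 : x.2 ⟨0, hN⟩ ^ 2 / 2 ≤ ∑ i, x.2 i ^ 2 / 2 :=
    Finset.single_le_sum (f := fun i => x.2 i ^ 2 / 2) (fun i _ => by positivity) (Finset.mem_univ _)
  have h2 : x.2 ⟨N - 1, Nat.sub_lt hN one_pos⟩ ^ 2 / 2 ≤ ∑ i, x.2 i ^ 2 / 2 :=
    Finset.single_le_sum (f := fun i => x.2 i ^ 2 / 2) (fun i _ => by positivity) (Finset.mem_univ _)
  linarith

/-- A single squared momentum is bounded by `2H` (`U, V ≥ 0`). [folklore] -/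
theorem sq_le_two_mul_hamiltonian (hU0 : ∀ q, 0 ≤ P.U q) (hV0 : ∀ r, 0 ≤ P.V r) (x : PhaseSpace N)
    (i : Fin N) : x.2 i ^ 2 ≤ 2 * P.hamiltonian N x := by
  have := P.site_le_hamiltonian hU0 hV0 N x i
  have := hU0 (x.1 i)
  linarith

section Bounds

variable (hU : ContDiff ℝ 2 P.U) (hV : ContDiff ℝ 2 P.V) (hU0 : ∀ q, 0 ≤ P.U q) (hV0 : ∀ r, 0 ≤ P.V r)
  (hN : 0 < N) (hγ : 0 ≤ P.γ) {T_L T_R : ℝ} (hTL : 0 ≤ T_L) (hTR : 0 ≤ T_R)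
include hU hV hU0 hV0 hN hγ hTL hTR

/-- **Uniform bound on the forward generator of the energy cutoff**: there is `K` with `|L a_R| ≤ K` on
phase space for all `R ≥ 1` (the `χ'`, `χ''` terms carry `1/R`, `1/R²` against `A + B ≤ 4H ≤ 8R`).
[folklore] -/
theorem abs_generator_energyCutoff_le :
    ∃ K : ℝ, 0 ≤ K ∧ ∀ R : ℝ, 1 ≤ R → ∀ x : PhaseSpace N,
      |sdeGenerator (P.drift N) (P.bathVecL N T_L) (P.bathVecR N T_R) (fun y => smoothCutoff (P.hamiltonian N y / R)) x| ≤ K := by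
  obtain ⟨M₁, hM₁0, hM₁⟩ := exists_bound_deriv_smoothCutoff
  obtain ⟨M₂, hM₂0, hM₂⟩ := exists_bound_deriv_deriv_smoothCutoff
  refine ⟨P.γ * (M₁ * (T_L + T_R + 8) + M₂ * (8 * (T_L + T_R))), by positivity, fun R hR x => ?_⟩
  have hR0 : 0 < R := by linarith
  have hL : 0 ≤ P.γ * T_L := mul_nonneg hγ hTL
  have hR' : 0 ≤ P.γ * T_R := mul_nonneg hγ hTR
  have h := generator_comp_hamiltonian hU hV hN hL hR' (hasDerivAt_cutoffProfile R)
    (hasDerivAt_deriv_cutoffProfile R) x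
  rw [h]
  set Hx := P.hamiltonian N x
  set A := x.2 ⟨0, hN⟩ ^ 2
  set B := x.2 ⟨N - 1, Nat.sub_lt hN one_pos⟩ ^ 2
  have hA0 : 0 ≤ A := sq_nonneg _
  have hB0 : 0 ≤ B := sq_nonneg _
  have hAB : A + B ≤ 4 * Hx := bath_sq_le_four_mul_hamiltonian hU0 hV0 hN x
  rw [abs_mul, abs_of_nonneg hγ]
  refine mul_le_mul_of_nonneg_left ?_ hγ
  -- either the derivative terms vanish, or `R ≤ H ≤ 2R`
  by_cases hshell : R ≤ Hx ∧ Hx ≤ 2 * R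
  · have hAB8 : A + B ≤ 8 * R := by linarith
    have hχ₁ := hM₁ (Hx / R)
    have hχ₂ := hM₂ (Hx / R)
    have t1 : |deriv smoothCutoff (Hx / R) / R * (T_L + T_R - A - B)| ≤ M₁ * (T_L + T_R + 8) := by
      rw [abs_mul, abs_div, abs_of_pos hR0]
      have h1 : |deriv smoothCutoff (Hx / R)| / R ≤ M₁ := by
        rw [div_le_iff₀ hR0]; nlinarith
      have h2 : |T_L + T_R - A - B| ≤ (T_L + T_R + 8) * R := by
        rw [abs_le]; constructor <;> nlinarith
      calc |deriv smoothCutoff (Hx / R)| / R * |T_L + T_R - A - B|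
          ≤ |deriv smoothCutoff (Hx / R)| / R * ((T_L + T_R + 8) * R) :=
            mul_le_mul_of_nonneg_left h2 (by positivity)
        _ = |deriv smoothCutoff (Hx / R)| * (T_L + T_R + 8) := by field_simp
        _ ≤ M₁ * (T_L + T_R + 8) := mul_le_mul_of_nonneg_right hχ₁ (by positivity)
    have t2 : |deriv (deriv smoothCutoff) (Hx / R) / R ^ 2 * (T_L * A + T_R * B)| ≤
        M₂ * (8 * (T_L + T_R)) := by
      rw [abs_mul, abs_div, abs_of_pos (by positivity : (0:ℝ) < R ^ 2),
        abs_of_nonneg (by positivity : 0 ≤ T_L * A + T_R * B)]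
      have h3 : T_L * A + T_R * B ≤ (T_L + T_R) * (8 * R) := by nlinarith
      have h4 : (T_L + T_R) * (8 * R) ≤ (8 * (T_L + T_R)) * R ^ 2 := by
        have hRR : R ≤ R ^ 2 := by nlinarith
        calc (T_L + T_R) * (8 * R) = (8 * (T_L + T_R)) * R := by ring
          _ ≤ (8 * (T_L + T_R)) * R ^ 2 := mul_le_mul_of_nonneg_left hRR (by positivity)
      calc |deriv (deriv smoothCutoff) (Hx / R)| / R ^ 2 * (T_L * A + T_R * B)
          ≤ |deriv (deriv smoothCutoff) (Hx / R)| / R ^ 2 * ((8 * (T_L + T_R)) * R ^ 2) :=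
            mul_le_mul_of_nonneg_left (h3.trans h4) (by positivity)
        _ = |deriv (deriv smoothCutoff) (Hx / R)| * (8 * (T_L + T_R)) := by field_simp
        _ ≤ M₂ * (8 * (T_L + T_R)) := mul_le_mul_of_nonneg_right hχ₂ (by positivity)
    exact (abs_add_le _ _).trans (add_le_add t1 t2)
  · have hout : Hx < R ∨ 2 * R < Hx := by
      by_contra hc
      push Not at hc
      exact hshell ⟨hc.1, hc.2⟩
    rw [deriv_smoothCutoff_div_eq_zero hR0 hout, deriv_deriv_smoothCutoff_div_eq_zero hR0 hout]
    simp only [zero_div, zero_mul, add_zero, abs_zero]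
    positivity

/-- **Uniform bound on the reversed generator of the energy cutoff, supported on the shell**: there is
`K` with `|L̂ a_R| ≤ K` everywhere and `L̂ a_R(x) = 0` unless `R ≤ H(x) ≤ 2R`, for all `R ≥ 1`. [folklore] -/
theorem abs_revGenerator_energyCutoff_le :
    ∃ K : ℝ, 0 ≤ K ∧ ∀ R : ℝ, 1 ≤ R → ∀ x : PhaseSpace N,
      |sdeGenerator (fun y => -P.drift N y) (P.bathVecL N T_L) (P.bathVecR N T_R) (fun y => smoothCutoff (P.hamiltonian N y / R)) x| ≤ K ∧
      (¬ (R ≤ P.hamiltonian N x ∧ P.hamiltonian N x ≤ 2 * R) →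
        sdeGenerator (fun y => -P.drift N y) (P.bathVecL N T_L) (P.bathVecR N T_R) (fun y => smoothCutoff (P.hamiltonian N y / R)) x = 0) := by
  obtain ⟨M₁, hM₁0, hM₁⟩ := exists_bound_deriv_smoothCutoff
  obtain ⟨M₂, hM₂0, hM₂⟩ := exists_bound_deriv_deriv_smoothCutoff
  refine ⟨P.γ * (M₁ * (T_L + T_R + 8) + M₂ * (8 * (T_L + T_R))), by positivity, fun R hR x => ?_⟩
  have hR0 : 0 < R := by linarith
  have hL : 0 ≤ P.γ * T_L := mul_nonneg hγ hTL
  have hR' : 0 ≤ P.γ * T_R := mul_nonneg hγ hTR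
  have h := revGenerator_comp_hamiltonian hU hV hN hL hR' (hasDerivAt_cutoffProfile R)
    (hasDerivAt_deriv_cutoffProfile R) x
  rw [h]
  set Hx := P.hamiltonian N x
  set A := x.2 ⟨0, hN⟩ ^ 2
  set B := x.2 ⟨N - 1, Nat.sub_lt hN one_pos⟩ ^ 2
  have hA0 : 0 ≤ A := sq_nonneg _
  have hB0 : 0 ≤ B := sq_nonneg _
  have hAB : A + B ≤ 4 * Hx := bath_sq_le_four_mul_hamiltonian hU0 hV0 hN x
  by_cases hshell : R ≤ Hx ∧ Hx ≤ 2 * R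
  · refine ⟨?_, fun hc => absurd hshell hc⟩
    rw [abs_mul, abs_of_nonneg hγ]
    refine mul_le_mul_of_nonneg_left ?_ hγ
    have hAB8 : A + B ≤ 8 * R := by linarith
    have hχ₁ := hM₁ (Hx / R)
    have hχ₂ := hM₂ (Hx / R)
    have t1 : |deriv smoothCutoff (Hx / R) / R * (T_L + T_R + A + B)| ≤ M₁ * (T_L + T_R + 8) := by
      rw [abs_mul, abs_div, abs_of_pos hR0, abs_of_nonneg (by positivity : 0 ≤ T_L + T_R + A + B)]
      have h2 : T_L + T_R + A + B ≤ (T_L + T_R + 8) * R := by nlinarith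
      calc |deriv smoothCutoff (Hx / R)| / R * (T_L + T_R + A + B)
          ≤ |deriv smoothCutoff (Hx / R)| / R * ((T_L + T_R + 8) * R) :=
            mul_le_mul_of_nonneg_left h2 (by positivity)
        _ = |deriv smoothCutoff (Hx / R)| * (T_L + T_R + 8) := by field_simp
        _ ≤ M₁ * (T_L + T_R + 8) := mul_le_mul_of_nonneg_right hχ₁ (by positivity)
    have t2 : |deriv (deriv smoothCutoff) (Hx / R) / R ^ 2 * (T_L * A + T_R * B)| ≤
        M₂ * (8 * (T_L + T_R)) := by
      rw [abs_mul, abs_div, abs_of_pos (by positivity : (0:ℝ) < R ^ 2),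
        abs_of_nonneg (by positivity : 0 ≤ T_L * A + T_R * B)]
      have h3 : T_L * A + T_R * B ≤ (T_L + T_R) * (8 * R) := by nlinarith
      have h4 : (T_L + T_R) * (8 * R) ≤ (8 * (T_L + T_R)) * R ^ 2 := by
        have hRR : R ≤ R ^ 2 := by nlinarith
        calc (T_L + T_R) * (8 * R) = (8 * (T_L + T_R)) * R := by ring
          _ ≤ (8 * (T_L + T_R)) * R ^ 2 := mul_le_mul_of_nonneg_left hRR (by positivity)
      calc |deriv (deriv smoothCutoff) (Hx / R)| / R ^ 2 * (T_L * A + T_R * B)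
          ≤ |deriv (deriv smoothCutoff) (Hx / R)| / R ^ 2 * ((8 * (T_L + T_R)) * R ^ 2) :=
            mul_le_mul_of_nonneg_left (h3.trans h4) (by positivity)
        _ = |deriv (deriv smoothCutoff) (Hx / R)| * (8 * (T_L + T_R)) := by field_simp
        _ ≤ M₂ * (8 * (T_L + T_R)) := mul_le_mul_of_nonneg_right hχ₂ (by positivity)
    exact (abs_add_le _ _).trans (add_le_add t1 t2)
  · have hout : Hx < R ∨ 2 * R < Hx := by
      by_contra hc
      push Not at hc
      exact hshell ⟨hc.1, hc.2⟩
    rw [deriv_smoothCutoff_div_eq_zero hR0 hout, deriv_deriv_smoothCutoff_div_eq_zero hR0 hout]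
    refine ⟨?_, fun _ => by simp⟩
    simp only [zero_div, zero_mul, add_zero, mul_zero, abs_zero]
    positivity

omit hN hγ hTL hTR in
/-- **The bath derivatives of the energy cutoff are `O(R^{-1/2})` and live on the shell**:
`D a_R(x)·(bathVec N k c) = χ'(H/R) c p_k / R`, so `|D a_R(x)·(bathVec N k c)| ≤ 2 M₁ |c| / √R` for
`R ≥ 1` (`p_k² ≤ 2H ≤ 4R` on the shell) and it vanishes unless `R ≤ H(x) ≤ 2R`. [folklore] -/
theorem abs_fderiv_energyCutoff_bathVec_le :
    ∃ C : ℝ, 0 ≤ C ∧ ∀ R : ℝ, 1 ≤ R → ∀ (x : PhaseSpace N) {k : ℕ} (hk : k < N) (c : ℝ),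
      |fderiv ℝ (fun y => smoothCutoff (P.hamiltonian N y / R)) x (bathVec N k c)| ≤ C * |c| / Real.sqrt R ∧
      (¬ (R ≤ P.hamiltonian N x ∧ P.hamiltonian N x ≤ 2 * R) →
        fderiv ℝ (fun y => smoothCutoff (P.hamiltonian N y / R)) x (bathVec N k c) = 0) := by
  obtain ⟨M₁, hM₁0, hM₁⟩ := exists_bound_deriv_smoothCutoff
  refine ⟨2 * M₁, by positivity, fun R hR x k hk c => ?_⟩
  have hR0 : 0 < R := by linarith
  have hH2 : ContDiff ℝ 2 (P.hamiltonian N) := P.contDiff_hamiltonian hU hV N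
  have hHd : Differentiable ℝ (P.hamiltonian N) := hH2.differentiable (by norm_num)
  have hD : fderiv ℝ (fun y => smoothCutoff (P.hamiltonian N y / R)) x (bathVec N k c) =
      deriv smoothCutoff (P.hamiltonian N x / R) / R * (c * x.2 ⟨k, hk⟩) := by
    rw [fderiv_comp_eq_smul (hasDerivAt_cutoffProfile R) hHd]
    simp only [FunLike.coe_smul, Pi.smul_apply, smul_eq_mul]
    rw [fderiv_hamiltonian_bathVec P hHd x hk c]
  rw [hD]
  set Hx := P.hamiltonian N x
  by_cases hshell : R ≤ Hx ∧ Hx ≤ 2 * R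
  · refine ⟨?_, fun hc => absurd hshell hc⟩
    have hp2 : x.2 ⟨k, hk⟩ ^ 2 ≤ 4 * R := by
      have := sq_le_two_mul_hamiltonian hU0 hV0 x ⟨k, hk⟩
      linarith [hshell.2]
    have hp : |x.2 ⟨k, hk⟩| ≤ 2 * Real.sqrt R := by
      have h4 : (4 : ℝ) * R = (2 * Real.sqrt R) ^ 2 := by
        rw [mul_pow, Real.sq_sqrt hR0.le]; norm_num
      rw [h4] at hp2
      exact abs_le_of_sq_le_sq' hp2 (by positivity) |>.2 |> fun h => by
        rw [abs_le]; exact ⟨(abs_le_of_sq_le_sq' hp2 (by positivity)).1, h⟩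
    have hsR : 0 < Real.sqrt R := Real.sqrt_pos.2 hR0
    have hRs : R = Real.sqrt R * Real.sqrt R := (Real.mul_self_sqrt hR0.le).symm
    rw [abs_mul, abs_mul, abs_div, abs_of_pos hR0, le_div_iff₀ hsR]
    calc |deriv smoothCutoff (Hx / R)| / R * (|c| * |x.2 ⟨k, hk⟩|) * Real.sqrt R
        ≤ M₁ / R * (|c| * (2 * Real.sqrt R)) * Real.sqrt R := by
          apply mul_le_mul_of_nonneg_right _ hsR.le
          exact mul_le_mul (div_le_div_of_nonneg_right (hM₁ _) hR0.le)
            (mul_le_mul_of_nonneg_left hp (abs_nonneg c)) (by positivity) (by positivity)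
      _ = 2 * M₁ * |c| * (Real.sqrt R * Real.sqrt R / R) := by ring
      _ = 2 * M₁ * |c| := by rw [← hRs, div_self hR0.ne', mul_one]
  · have hout : Hx < R ∨ 2 * R < Hx := by
      by_contra hc
      push Not at hc
      exact hshell ⟨hc.1, hc.2⟩
    rw [deriv_smoothCutoff_div_eq_zero hR0 hout]
    refine ⟨?_, fun _ => by simp⟩
    simp only [zero_div, zero_mul, abs_zero]
    positivity

end Bounds

end Summit.AtomisticToContinuum.FouriersLaw.Theorems.NessUnique

end
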